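import Literature.Computation.Certificates.SumOfSquares
import Literature.Analysis.ValidatedNumerics.SparsePolynomialEnclosure
import HarnessLib

/-!
# Natural interval extension of `SOS.Poly` term lists over rational boxes (Moore 1979, Cor. 3.1)

Topic `Literature/Computation/Certificates` (companion of `SumOfSquares.lean`, whose sparse polynomials
`SOS.Poly = List (SOS.Monomial × ℚ)` with the evaluation semantics `SOS.Poly.eval x` (`x : ℕ → R`) are the
data of every Gram-form SOS / Positivstellensatz certificate in the tree, and of
`Literature/Analysis/ValidatedNumerics/IntervalEnclosure.lean`, whose Moore product / power / outward rounding on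
`NonemptyInterval ℚ` are the interval operations used; interval addition lemmas reused from
`SparsePolynomialEnclosure.lean`: `QMvPoly.ratCast_add`, `QMvPoly.add_mem_add_of_mem`, `QMvPoly.ratCast_zero`). Everything here is PROVED and structurally recursive
(kernel-evaluable by `decide`); no named fact, no number.

PURPOSE. A certificate file proves polynomial inequalities on semialgebraic sets; a CONSUMER often needs the
cheaper converse direction «this explicit box lies inside the certified sublevel set», i.e. an UPPER bound of a
fixed polynomial `V` (hundreds of monomials, rational coefficients) over a box with rational corners. Moore's
natural interval extension in monomial form gives such a bound by pure rational arithmetic: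
`V(x) ∈ Σ_{(m,c)} [c,c] · Π_k B_k^{m_k}` whenever `x_k ∈ B_k` for every variable index `k`
(R. E. Moore, *Methods and Applications of Interval Analysis*, SIAM 1979, §3.3 Corollary 3.1: a rational interval
function that is an interval extension of `f` encloses the range of `f`; §2.2 for the product). The sister file
`Literature/Analysis/ValidatedNumerics/SparsePolynomialEnclosure.lean` proves the same statement for ITS term lists
read in `MvPolynomial (Fin n) R`; this file proves it for the `SOS.Poly.eval` semantics (variables `ℕ → R`, dense
exponent vectors read by `Monomial.evalFrom`), so that no bridge between the two semantics is needed.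

* `Monomial.ienclFrom B k m` / `Poly.iencl B p` — the natural interval extension mirroring `Monomial.evalFrom` /
  `Poly.eval` term by term; the box is a LIST of rational intervals, variable `k` ranging over `B.getD k [0,0]`
  (variables past the end of the list are enclosed by the point interval `[0, 0]`, matching `SOS.vars`).
* `Monomial.evalFrom_mem_ienclFrom`, `Poly.eval_mem_iencl` — the inclusion property (Moore 1979 §3.3 Cor. 3.1) in
  any linear ordered field `K` (via `NonemptyInterval.ratCast`); corollaries `Poly.eval_le_of_iencl`,
  `Poly.le_eval_of_iencl` (compare an endpoint with a rational constant — the `decide` shape), and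
  `vars_mem_getD` (the hypothesis for `x = SOS.vars l`, `l : List K`, from entrywise membership).

Deliberately NOT here: subdivision / centred forms (tighter enclosures), outward rounding of the RESULT (apply
`NonemptyInterval.roundOut` to the box beforehand if the endpoints must stay small), non-polynomial expressions.
-/

namespace Literature.Computation.Certificates

namespace SOS

open NonemptyInterval Literature.Analysis.ValidatedNumerics

/-! ### The natural interval extension, mirroring `evalFrom` / `eval` -/

namespace Monomial

/-- Natural interval extension of the exponent vector `m` read from variable index `k` on, over the box `B`
(variable `j` ranges over `B.getD j [0,0]`): `ienclFrom B k [e₀, e₁, …] = B_k^{e₀} · B_{k+1}^{e₁} ⋯` with Moore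
powers and products — the interval twin of `Monomial.evalFrom`. [cite: Moore1979, §3.3 Corollary 3.1] -/
def ienclFrom (B : List (NonemptyInterval ℚ)) : ℕ → Monomial → NonemptyInterval ℚ
  | _, [] => pure 1
  | k, e :: es => ((B.getD k (pure 0)).moorePow e).mooreMul (ienclFrom B (k + 1) es)

/-- `ienclFrom` of the empty exponent vector is `[1, 1]` (empty product). [cite: Moore1979, §3.3 Corollary 3.1 (monomial form)] -/
@[simp] theorem ienclFrom_nil (B : List (NonemptyInterval ℚ)) (k : ℕ) : ienclFrom B k [] = pure 1 := rfl

/-- `ienclFrom` of a nonempty exponent vector: one Moore power times the rest. [cite: Moore1979, §3.3 Corollary 3.1 (monomial form)] -/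
@[simp] theorem ienclFrom_cons (B : List (NonemptyInterval ℚ)) (k e : ℕ) (es : Monomial) :
    ienclFrom B k (e :: es) = ((B.getD k (pure 0)).moorePow e).mooreMul (ienclFrom B (k + 1) es) := rfl

variable {K : Type*} [Field K] [LinearOrder K] [IsStrictOrderedRing K]

/-- **Inclusion property for monomials** (Moore 1979 §3.3 Cor. 3.1): if every variable `x j` lies in
`B.getD j [0,0]`, then `evalFrom x k m ∈ ienclFrom B k m`. [cite: Moore1979, §3.3 Corollary 3.1] -/
theorem evalFrom_mem_ienclFrom {B : List (NonemptyInterval ℚ)} {x : ℕ → K}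
    (hx : ∀ j, x j ∈ (B.getD j (pure 0)).ratCast K) :
    ∀ (k : ℕ) (m : Monomial), evalFrom x k m ∈ (ienclFrom B k m).ratCast K
  | k, [] => by
      rw [evalFrom_nil, ienclFrom_nil, ratCast_pure, Rat.cast_one]
      exact mem_pure_self _
  | k, e :: es => by
      rw [evalFrom_cons, ienclFrom_cons, ratCast_mooreMul, ratCast_moorePow]
      exact mul_mem_mooreMul (pow_mem_moorePow (hx k) e) (evalFrom_mem_ienclFrom hx (k + 1) es)

/-- `eval` form of the monomial inclusion property. [cite: Moore1979, §3.3 Corollary 3.1] -/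
theorem eval_mem_ienclFrom {B : List (NonemptyInterval ℚ)} {x : ℕ → K}
    (hx : ∀ j, x j ∈ (B.getD j (pure 0)).ratCast K) (m : Monomial) :
    eval x m ∈ (ienclFrom B 0 m).ratCast K :=
  evalFrom_mem_ienclFrom hx 0 m

end Monomial

namespace Poly

/-- Natural interval extension of a term list over the box `B`, in monomial form:
`iencl B p = Σ_{(m,c) ∈ p} [c,c] · ienclFrom B 0 m` — the interval twin of `Poly.eval`.
[cite: Moore1979, §3.3 Corollary 3.1] -/
def iencl (B : List (NonemptyInterval ℚ)) : Poly → NonemptyInterval ℚ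
  | [] => 0
  | (m, c) :: p => (pure c).mooreMul (Monomial.ienclFrom B 0 m) + iencl B p

/-- `iencl` of the empty term list is `[0, 0]` (empty sum). [cite: Moore1979, §3.3 Corollary 3.1 (monomial form)] -/
@[simp] theorem iencl_nil (B : List (NonemptyInterval ℚ)) : iencl B [] = 0 := rfl

/-- `iencl` of a cons: one term `[c,c]·Π B_k^{m_k}` plus the rest. [cite: Moore1979, §3.3 Corollary 3.1 (monomial form)] -/
@[simp] theorem iencl_cons (B : List (NonemptyInterval ℚ)) (m : Monomial) (c : ℚ) (p : Poly) :
    iencl B ((m, c) :: p) = (pure c).mooreMul (Monomial.ienclFrom B 0 m) + iencl B p := rfl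

variable {K : Type*} [Field K] [LinearOrder K] [IsStrictOrderedRing K]

/-- **Moore's Corollary 3.1 for `SOS.Poly.eval`**: if every variable `x j` lies in `B.getD j [0,0]`, then
`p.eval x ∈ iencl B p` (as an interval of `K` after `ratCast`). [cite: Moore1979, §3.3 Corollary 3.1] -/
theorem eval_mem_iencl {B : List (NonemptyInterval ℚ)} {x : ℕ → K}
    (hx : ∀ j, x j ∈ (B.getD j (pure 0)).ratCast K) : ∀ p : Poly, eval x p ∈ (iencl B p).ratCast K
  | [] => by
      rw [eval_nil, iencl_nil]
      rw [QMvPoly.ratCast_zero]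
      exact NonemptyInterval.zero_mem_zero
  | (m, c) :: p => by
      rw [eval_cons, iencl_cons, QMvPoly.ratCast_add, ratCast_mooreMul, ratCast_pure]
      exact QMvPoly.add_mem_add_of_mem (mul_mem_mooreMul (mem_pure_self _) (Monomial.eval_mem_ienclFrom hx m))
        (eval_mem_iencl hx p)

/-- Upper-bound form (the shape a kernel `decide` discharges): if the right endpoint of `iencl B p` is `≤ c`,
then `p.eval x ≤ c` on the box. [cite: Moore1979, §3.3 Corollary 3.1] -/
theorem eval_le_of_iencl {B : List (NonemptyInterval ℚ)} {x : ℕ → K}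
    (hx : ∀ j, x j ∈ (B.getD j (pure 0)).ratCast K) (p : Poly) {c : ℚ} (h : (iencl B p).snd ≤ c) :
    eval x p ≤ (c : K) :=
  ((eval_mem_iencl hx p).2).trans (by simpa using (Rat.cast_le (K := K)).2 h)

/-- Lower-bound form: if `c ≤` the left endpoint of `iencl B p`, then `c ≤ p.eval x` on the box.
[cite: Moore1979, §3.3 Corollary 3.1] -/
theorem le_eval_of_iencl {B : List (NonemptyInterval ℚ)} {x : ℕ → K}
    (hx : ∀ j, x j ∈ (B.getD j (pure 0)).ratCast K) (p : Poly) {c : ℚ} (h : c ≤ (iencl B p).fst) :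
    (c : K) ≤ eval x p :=
  le_trans (by simpa using (Rat.cast_le (K := K)).2 h) (eval_mem_iencl hx p).1

end Poly

/-! ### The hypothesis for `x = SOS.vars l` -/

section Vars

variable {K : Type*} [Field K] [LinearOrder K] [IsStrictOrderedRing K]

/-- Entrywise membership of a list of values in a list of intervals OF THE SAME LENGTH gives the box hypothesis
«`x_j ∈ B_j` for every variable» of `Poly.eval_mem_iencl` for the assignment `SOS.vars l` (past the end both sides are
`0 ∈ [0, 0]`). [cite: Moore1979, §3.3 Corollary 3.1 (hypothesis `x ∈ B`)] -/
theorem vars_mem_getD (l : List K) (B : List (NonemptyInterval ℚ)) (hlen : l.length = B.length)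
    (h : ∀ (i : ℕ) (hi : i < l.length), l[i] ∈ (B[i]'(hlen ▸ hi)).ratCast K) (j : ℕ) :
    vars l j ∈ (B.getD j (pure 0)).ratCast K := by
  unfold vars
  by_cases hj : j < l.length
  · rw [List.getD_eq_getElem _ _ hj, List.getD_eq_getElem _ _ (hlen ▸ hj)]
    exact h j hj
  · rw [List.getD_eq_default _ _ (not_lt.1 hj), List.getD_eq_default _ _ (by rw [← hlen]; exact not_lt.1 hj),
      ratCast_pure, Rat.cast_zero]
    exact mem_pure_self _

end Vars

/-! ### Test (kernel-checked) -/

section Test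

/-- Test: `p(x₀, x₁) = x₀² − x₀x₁ + 3` over `[1, 2] × [0, 1]` is enclosed by `iencl`; in particular `p ≤ 7` there. -/
example (a b : ℝ) (ha : 1 ≤ a ∧ a ≤ 2) (hb : 0 ≤ b ∧ b ≤ 1) : a ^ 2 - a * b + 3 ≤ (7 : ℝ) := by
  have hB : ∀ j, vars [a, b] j ∈
      (([⟨(1, 2), by norm_num⟩, ⟨(0, 1), by norm_num⟩] : List (NonemptyInterval ℚ)).getD j (pure 0)).ratCast ℝ := by
    refine vars_mem_getD [a, b] _ rfl ?_
    intro i hi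
    match i, hi with
    | 0, _ => exact ⟨by simpa using ha.1, by simpa using ha.2⟩
    | 1, _ => exact ⟨by simpa using hb.1, by simpa using hb.2⟩
  have h := Poly.eval_le_of_iencl hB [([2], 1), ([1, 1], -1), ([], 3)] (c := 7) (by decide +kernel)
  simp only [Poly.eval_cons, Poly.eval_nil, Monomial.eval_eq, Monomial.evalFrom_cons, Monomial.evalFrom_nil,
    vars_cons_zero, vars_cons_succ] at h
  push_cast at h
  linarith

end Test

end SOS

end Literature.Computation.Certificates
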